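import Literature.AlgebraicGeometry.HodgeTheory.SurjectivePullbackWedgeKaehlerPower
import Literature.AlgebraicGeometry.HodgeTheory.KunnethStandardConjectureFactors
import Literature.AlgebraicGeometry.HodgeTheory.KunnethStandardConjectureInstances
import HarnessLib

/-!
# The Künneth standard conjecture `C` descends along EVERY surjective morphism of smooth projective
# complex varieties (Kahn Lemma 6.30 (2) / Kleiman, in any relative dimension, unconditionally)

Family `hodge`, layer `Literature/AlgebraicGeometry/HodgeTheory`; lane `lit-hodgefound`. THEOREMS ONLY
(no definition, no named fact; D-0026). On the carriers of `KunnethComponentsOfHodgeClasses` (Künneth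
FAMILIES `π : Fin (2n+1) → H²ⁿ((X ⊗ X)(ℂ); ℂ)` of `cl(Δ_X) = diagonalClass hX`, `algebraicClasses`):

B. Kahn, *Zeta and L-functions of varieties and motives* (2020), §6.9 Lemma 6.30 (2) ("if `C(X)` holds
and `h(Y)` is a direct summand of `h(X)`, then `C(Y)` holds"), and S. Kleiman, *Algebraic cycles and the
Weil conjectures* (1968), §1–§2, give `C(X) ⟹ C(W)` for `g : X ⟶ W` surjective and generically finite
(Voisin I Rem. 7.29, `φ_* φ^* = deg φ · id`; the tree's `KunnethStandardConjectureSurjections`), and —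
for `g` of relative dimension `r` carrying a divisor class `η` with `g_*(ηʳ) ≠ 0` — through the
correspondence `Γ_g ∘ (ηʳ ∪ –) ∘ ᵗΓ_g` (the tree's `KunnethStandardConjectureRelativeDimension`, no
moving lemma: cupping with divisor powers is unconditionally algebraic). The remaining input,
**`g_*(ηʳ) ≠ 0` for the hyperplane class `η` along every surjection**, is Voisin I Lemma 7.28 with the
wedge kept (`∫_X φ^* θ ∧ ωʳ ≠ 0`), proved in `SurjectivePullbackWedgeKaehlerPower`. Hence:

* §1 `dim_le_of_surjective` (`dim W ≤ dim X` for `g : X ⟶ W` surjective: `g^*` is injective on the top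
  class of `W`, Lemma 7.28), `exists_mem_algebraicClasses_one_complexGysin_lefschetzPow_ne_zero_of_surjective`
  (a DIVISOR class `η ∈ N¹ H²(X)` with `g_*(ηʳ) ≠ 0`: the rational Kähler class of a Kähler–rational
  datum, algebraic by Lefschetz `(1,1)`).
* §2 `kunnethComponent_diagonalClass_mem_algebraicClasses_of_surjective_of_add_eq` (Künneth families),
  `…_of_forall_of_add_eq`, and **`kunnethComponents_algebraic_of_surjective` — `C(X) ⟹ C(W)` FOR EVERY
  SURJECTIVE MORPHISM `g : X ⟶ W` OF SMOOTH PROJECTIVE COMPLEX VARIETIES, with no hypothesis on the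
  dimensions.**
* §3 Unconditional instances (`kunnethComponents_algebraic_of_surjective_…`): `C(W)` for every `W`
  DOMINATED (in any relative dimension) by a complex abelian variety (`…_abelianVariety`), by `ℙᴺ`
  (`…_projectiveSpace` — a surjective MORPHISM `ℙᴺ ⟶ W` is required), by a smooth hypersurface
  (`…_isSmoothHypersurface`), by a product `X ⊗ Y` with `C(X)`, `C(Y)` (`…_tensor`), by a product of
  two varieties of dimension `≤ 2` (`…_tensor_of_le_two`), by `A ⊗ Y` with `C(Y)` or `dim Y ≤ 2`
  (`…_abelianVariety_tensor`, `…_abelianVariety_tensor_of_le_two`), by a triple product of varieties of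
  dimension `≤ 2` (`…_tensor_tensor_of_le_two`).

## References

* [Kahn2020] B. Kahn, Zeta and L-functions of varieties and motives, LMS LN 462, CUP 2020, §6.9
  Def. 6.29, Lemma 6.30 (2)–(3) and its proof (p. 125), Theorem 6.31.
* [Kleiman1968AlgebraicCycles] S. Kleiman, Algebraic cycles and the Weil conjectures, in: Dix exposés
  sur la cohomologie des schémas (1968), §1–§2, Appendix (2A11).
* [Voisin2002] [VoisinHodgeI2002] C. Voisin, Hodge Theory and Complex Algebraic Geometry I, CUP 2002,
  §7.3.2 Lemma 7.28 (p. 150), Remark 7.29; §7.1.2.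
* [Voisin2025] C. Voisin, Hodge and generalized Hodge conjectures, coniveau and algebraic cycles,
  J. Open Math. Probl. 1 (2025), §3.2.1 Cor. 3.9.
-/

noncomputable section

open CategoryTheory AlgebraicGeometry MonoidalCategory CartesianMonoidalCategory Finset
open Literature.AlgebraicTopology.SingularHomology Literature.Geometry.Kaehler
open Literature.AlgebraicGeometry.Motives (IsSmoothProjective ComplexPoints projectiveSpace
  isSmoothProjective_projectiveSpace_holds IsSmoothHypersurface)

namespace Literature.AlgebraicGeometry.HodgeTheory

variable {n m l k d : ℕ} {X W Y Z V : Motives.SchemeOver ℂ}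

/-! ### §1 The dimension drops along a surjection; a divisor class with `g_*(ηʳ) ≠ 0` -/

/-- **`dim W ≤ dim X` for a surjective morphism `g : X ⟶ W` of smooth projective complex varieties**:
`g^*` is injective on `H^{2 dim W}(W(ℂ); ℂ) ≠ 0` (Voisin I Lemma 7.28, the tree's
`complexBetti_map_injective_of_surjective`), while `Hᵏ(X(ℂ); ℂ) = 0` for `k > 2 dim X`. The same
statement is the tree's `SurjectiveDescent.dim_le_of_surjective` (`HodgeConjectureDescendsAlongSurjections`,
whose import cone and this file's are incomparable); the two are interchangeable — this copy only spares
importing the Hodge-conjecture descent stack here.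
[cite: Voisin2002, §7.3.2 Lemma 7.28] [cite: HatcherAT2002, §3.3 Thm. 3.26] -/
theorem dim_le_of_surjective (hX : IsSmoothProjective n X) (hW : IsSmoothProjective m W) (g : X ⟶ W)
    [Surjective g.left] : m ≤ n := by
  by_contra h
  obtain ⟨ω, hω⟩ := exists_traceC_eq_one hW
  have hω0 : ω ≠ 0 := by
    rintro rfl
    rw [map_zero] at hω
    exact zero_ne_one hω
  haveI := subsingleton_complexBetti hX (show 2 * n < 2 * m by omega)
  exact hω0 (complexBetti_map_injective_of_surjective hW hX g (2 * m)
    (Subsingleton.elim (complexBetti.map g (2 * m) ω) (complexBetti.map g (2 * m) 0)))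

/-- **Every surjective morphism `g : X ⟶ W` of smooth projective complex varieties, `dim X = dim W + r`,
carries a divisor class `η ∈ N¹ H²(X(ℂ); ℂ)` with `g_*(ηʳ) ≠ 0`**: the complexified rational Kähler
class `η ⊗ 1` of a Kähler–rational datum of `X` (they exist, `nonempty_kaehlerRationalDatum`; the class
is algebraic — a rational multiple of the hyperplane class, Lefschetz `(1,1)`,
`KaehlerRationalDatum.ofRatClass_eta_mem_algebraicClasses`), for which
`KaehlerRationalDatum.complexGysin_lefschetzPow_one_ne_zero_of_surjective` (Voisin I Lemma 7.28 with the
wedge `∧ ωʳ` kept) gives `g_*(Lʳ_η 1) ≠ 0`. [cite: Voisin2002, §7.3.2 Lemma 7.28 and Remark 7.29]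
[cite: VoisinHodgeI2002, §7.1.2 and Thm. 7.10] -/
theorem exists_mem_algebraicClasses_one_complexGysin_lefschetzPow_ne_zero_of_surjective
    (hX : IsSmoothProjective n X) (hW : IsSmoothProjective m W) (g : X ⟶ W) [Surjective g.left]
    {r : ℕ} (hr : m + r = n) :
    ∃ η ∈ algebraicClasses X 1,
      complexGysin complexOrientationFamily hX hW g (show (0 + 2 * r) + 2 * m = 0 + 2 * n by omega)
        (lefschetzPow η r 0 (singularCohomology.one ℂ (ComplexPoints X))) ≠ 0 := by
  obtain ⟨D⟩ := nonempty_kaehlerRationalDatum hX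
  exact ⟨D.Hη, D.ofRatClass_eta_mem_algebraicClasses hX,
    D.complexGysin_lefschetzPow_one_ne_zero_of_surjective hX hW g hr⟩

/-! ### §2 `C(X) ⟹ C(W)` along every surjection -/

section Family

variable {π : Fin (2 * n + 1) → complexBetti (X ⊗ X) (2 * n)}
  {πW : Fin (2 * m + 1) → complexBetti (W ⊗ W) (2 * m)}

/-- **`C(X) ⟹ C(W)` ALONG A SURJECTIVE `g : X ⟶ W` OF RELATIVE DIMENSION `r`** (Kahn Lemma 6.30 (2) for
the direct summand `h(W) ⊂ h(X)` cut out by `c⁻¹ Γ_g ∘ (ηʳ ∪ –) ∘ ᵗΓ_g`, `η` a divisor class with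
`g_*(ηʳ) = c · 1 ≠ 0`, which exists by §1): if the members of one Künneth decomposition `π` of `cl(Δ_X)`
are algebraic, so is every member of every Künneth decomposition of `cl(Δ_W)`.
[cite: Kahn2020, §6.9 Lemma 6.30 (2) and its proof] [cite: Kleiman1968AlgebraicCycles, §1–§2]
[cite: Voisin2002, §7.3.2 Lemma 7.28] -/
theorem kunnethComponent_diagonalClass_mem_algebraicClasses_of_surjective_of_add_eq
    (hX : IsSmoothProjective n X) (hW : IsSmoothProjective m W) (g : X ⟶ W) [Surjective g.left]
    {r : ℕ} (hr : m + r = n)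
    (hπ : ∀ i : Fin (2 * n + 1), π i ∈ kunnethPiece X X (show (2 * n - (i : ℕ)) + i = 2 * n by omega))
    (hΔ : ∑ i, π i = diagonalClass hX) (hC : ∀ i, π i ∈ algebraicClasses (X ⊗ X) n)
    (hπW : ∀ i : Fin (2 * m + 1), πW i ∈ kunnethPiece W W (show (2 * m - (i : ℕ)) + i = 2 * m by omega))
    (hΔW : ∑ i, πW i = diagonalClass hW) (i : Fin (2 * m + 1)) :
    πW i ∈ algebraicClasses (W ⊗ W) m := by
  obtain ⟨η, hη, hne⟩ :=
    exists_mem_algebraicClasses_one_complexGysin_lefschetzPow_ne_zero_of_surjective hX hW g hr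
  exact kunnethComponent_diagonalClass_mem_algebraicClasses_of_lefschetzPow_ne_zero hX hW g hr hη hne hπ
    hΔ hC hπW hΔW i

end Family

/-- **`C(X) ⟹ C(W)` along a surjective `g : X ⟶ W` with `dim X = dim W + r`, family-free form.**
[cite: Kahn2020, §6.9 Lemma 6.30 (2)] [cite: Kleiman1968AlgebraicCycles, §1–§2] -/
theorem kunnethComponent_diagonalClass_mem_algebraicClasses_of_surjective_of_forall_of_add_eq
    (hX : IsSmoothProjective n X) (hW : IsSmoothProjective m W) (g : X ⟶ W) [Surjective g.left]
    {r : ℕ} (hr : m + r = n)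
    (hCX : ∀ (πX : Fin (2 * n + 1) → complexBetti (X ⊗ X) (2 * n)),
      (∀ i : Fin (2 * n + 1), πX i ∈ kunnethPiece X X (show (2 * n - (i : ℕ)) + i = 2 * n by omega)) →
      ∑ i, πX i = diagonalClass hX → ∀ i, πX i ∈ algebraicClasses (X ⊗ X) n)
    {πW : Fin (2 * m + 1) → complexBetti (W ⊗ W) (2 * m)}
    (hπW : ∀ i : Fin (2 * m + 1), πW i ∈ kunnethPiece W W (show (2 * m - (i : ℕ)) + i = 2 * m by omega))
    (hΔW : ∑ i, πW i = diagonalClass hW) (i : Fin (2 * m + 1)) :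
    πW i ∈ algebraicClasses (W ⊗ W) m := by
  obtain ⟨η, hη, hne⟩ :=
    exists_mem_algebraicClasses_one_complexGysin_lefschetzPow_ne_zero_of_surjective hX hW g hr
  exact kunnethComponent_diagonalClass_mem_algebraicClasses_of_lefschetzPow_ne_zero_of_forall hX hW g hr
    hη hne hCX hπW hΔW i

/-- **THE KÜNNETH STANDARD CONJECTURE DESCENDS ALONG EVERY SURJECTIVE MORPHISM OF SMOOTH PROJECTIVE
COMPLEX VARIETIES: `C(X) ⟹ C(W)` for `g : X ⟶ W` surjective**, with no hypothesis on the dimensions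
(`dim W ≤ dim X` automatically, `dim_le_of_surjective`): if every Künneth component of every Künneth
decomposition of `cl(Δ_X)` is algebraic, so is every Künneth component of every Künneth decomposition of
`cl(Δ_W)`. In print: Kahn Lemma 6.30 (2) (`h(W)` is a direct summand of `h(X)` — here realised WITHOUT
Chow motives, by the correspondence `Γ_g ∘ (ηʳ ∪ –) ∘ ᵗΓ_g` with `g_*(ηʳ) ≠ 0` for the hyperplane
class, Voisin I Lemma 7.28). [cite: Kahn2020, §6.9 Lemma 6.30 (2) and its proof]
[cite: Kleiman1968AlgebraicCycles, §1–§2] [cite: Voisin2002, §7.3.2 Lemma 7.28 and Remark 7.29] -/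
theorem kunnethComponents_algebraic_of_surjective (hX : IsSmoothProjective n X)
    (hW : IsSmoothProjective m W) (g : X ⟶ W) [Surjective g.left]
    (hCX : ∀ (πX : Fin (2 * n + 1) → complexBetti (X ⊗ X) (2 * n)),
      (∀ i : Fin (2 * n + 1), πX i ∈ kunnethPiece X X (show (2 * n - (i : ℕ)) + i = 2 * n by omega)) →
      ∑ i, πX i = diagonalClass hX → ∀ i, πX i ∈ algebraicClasses (X ⊗ X) n)
    {πW : Fin (2 * m + 1) → complexBetti (W ⊗ W) (2 * m)}
    (hπW : ∀ i : Fin (2 * m + 1), πW i ∈ kunnethPiece W W (show (2 * m - (i : ℕ)) + i = 2 * m by omega))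
    (hΔW : ∑ i, πW i = diagonalClass hW) (i : Fin (2 * m + 1)) :
    πW i ∈ algebraicClasses (W ⊗ W) m :=
  kunnethComponent_diagonalClass_mem_algebraicClasses_of_surjective_of_forall_of_add_eq hX hW g
    (r := n - m) (by have := dim_le_of_surjective hX hW g; omega) hCX hπW hΔW i

/-! ### §3 Unconditional instances: varieties dominated, in any relative dimension, by varieties with `C` -/

/-- **`C(W)` for every `W` dominated by a complex abelian variety** (a surjective `g : A ⟶ W`, ANY
relative dimension): the tree's `C(A)` (`AbelianVariety.kunnethComponent_diagonalClass_mem_algebraicClasses`,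
Lieberman–Kleiman) descends (§2). [cite: Kahn2020, §6.9 Lemma 6.30 (2) and Theorem 6.31 (3)]
[cite: Kleiman1968AlgebraicCycles, §2 Appendix (2A11)] -/
theorem kunnethComponents_algebraic_of_surjective_abelianVariety (A : Motives.AbelianVariety ℂ)
    (hW : IsSmoothProjective m W) (g : A.X ⟶ W) [Surjective g.left]
    {πW : Fin (2 * m + 1) → complexBetti (W ⊗ W) (2 * m)}
    (hπW : ∀ i : Fin (2 * m + 1), πW i ∈ kunnethPiece W W (show (2 * m - (i : ℕ)) + i = 2 * m by omega))
    (hΔW : ∑ i, πW i = diagonalClass hW) (i : Fin (2 * m + 1)) :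
    πW i ∈ algebraicClasses (W ⊗ W) m :=
  kunnethComponents_algebraic_of_surjective (Motives.AbelianVariety.isSmoothProjective_holds (A := A)) hW g
    (fun _ hπA hΔA j ↦ A.kunnethComponent_diagonalClass_mem_algebraicClasses hπA hΔA j) hπW hΔW i

/-- **`C(W)` for every `W` dominated by a projective space** (a surjective MORPHISM `g : ℙᴺ ⟶ W`):
`C(ℙᴺ)` (`kunnethComponent_diagonalClass_mem_algebraicClasses_projectiveSpace`) descends (§2).
[cite: Kahn2020, §6.9 Lemma 6.30 (2)] [cite: Kleiman1968AlgebraicCycles, §2] -/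
theorem kunnethComponents_algebraic_of_surjective_projectiveSpace (N : ℕ) (hW : IsSmoothProjective m W)
    (g : projectiveSpace N ℂ ⟶ W) [Surjective g.left]
    {πW : Fin (2 * m + 1) → complexBetti (W ⊗ W) (2 * m)}
    (hπW : ∀ i : Fin (2 * m + 1), πW i ∈ kunnethPiece W W (show (2 * m - (i : ℕ)) + i = 2 * m by omega))
    (hΔW : ∑ i, πW i = diagonalClass hW) (i : Fin (2 * m + 1)) :
    πW i ∈ algebraicClasses (W ⊗ W) m :=
  kunnethComponents_algebraic_of_surjective
    (isSmoothProjective_projectiveSpace_holds ℂ N : IsSmoothProjective N (projectiveSpace N ℂ)) hW g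
    (fun _ hπP hΔP j ↦ kunnethComponent_diagonalClass_mem_algebraicClasses_projectiveSpace N hπP hΔP j)
    hπW hΔW i

/-- **`C(W)` for every `W` dominated by a smooth hypersurface of `ℙⁿ⁺¹`** (surjective `g : V ⟶ W`, any
relative dimension). [cite: Kahn2020, §6.9 Lemma 6.30 (2)] [cite: Kleiman1968AlgebraicCycles, §2] -/
theorem kunnethComponents_algebraic_of_surjective_isSmoothHypersurface (hV : IsSmoothHypersurface n d V)
    (hW : IsSmoothProjective m W) (g : V ⟶ W) [Surjective g.left]
    {πW : Fin (2 * m + 1) → complexBetti (W ⊗ W) (2 * m)}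
    (hπW : ∀ i : Fin (2 * m + 1), πW i ∈ kunnethPiece W W (show (2 * m - (i : ℕ)) + i = 2 * m by omega))
    (hΔW : ∑ i, πW i = diagonalClass hW) (i : Fin (2 * m + 1)) :
    πW i ∈ algebraicClasses (W ⊗ W) m :=
  kunnethComponents_algebraic_of_surjective hV.1 hW g
    (fun _ hπV hΔV j ↦ kunnethComponent_diagonalClass_mem_algebraicClasses_of_isSmoothHypersurface hV hπV hΔV j)
    hπW hΔW i

/-- **`C(W)` for every `W` dominated by a product `X ⊗ Y` with `C(X)` and `C(Y)`** (surjective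
`g : X ⊗ Y ⟶ W`, any relative dimension): `C(X) ∧ C(Y) ⟹ C(X ⊗ Y)`
(`kunnethComponent_diagonalClass_mem_algebraicClasses_tensor_of_forall`) descends (§2).
[cite: Kahn2020, §6.9 Lemma 6.30 (2)–(3)] -/
theorem kunnethComponents_algebraic_of_surjective_tensor (hX : IsSmoothProjective l X)
    (hY : IsSmoothProjective k Y) (hW : IsSmoothProjective m W) (g : X ⊗ Y ⟶ W) [Surjective g.left]
    (hCX : ∀ (πX : Fin (2 * l + 1) → complexBetti (X ⊗ X) (2 * l)),
      (∀ i : Fin (2 * l + 1), πX i ∈ kunnethPiece X X (show (2 * l - (i : ℕ)) + i = 2 * l by omega)) →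
      ∑ i, πX i = diagonalClass hX → ∀ i, πX i ∈ algebraicClasses (X ⊗ X) l)
    (hCY : ∀ (πY : Fin (2 * k + 1) → complexBetti (Y ⊗ Y) (2 * k)),
      (∀ j : Fin (2 * k + 1), πY j ∈ kunnethPiece Y Y (show (2 * k - (j : ℕ)) + j = 2 * k by omega)) →
      ∑ j, πY j = diagonalClass hY → ∀ j, πY j ∈ algebraicClasses (Y ⊗ Y) k)
    {πW : Fin (2 * m + 1) → complexBetti (W ⊗ W) (2 * m)}
    (hπW : ∀ i : Fin (2 * m + 1), πW i ∈ kunnethPiece W W (show (2 * m - (i : ℕ)) + i = 2 * m by omega))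
    (hΔW : ∑ i, πW i = diagonalClass hW) (i : Fin (2 * m + 1)) :
    πW i ∈ algebraicClasses (W ⊗ W) m :=
  kunnethComponents_algebraic_of_surjective (Motives.IsSmoothProjective.tensor_holds hX hY) hW g
    (fun _ hπ hΔ j ↦
      kunnethComponent_diagonalClass_mem_algebraicClasses_tensor_of_forall hX hY hCX hCY hπ hΔ j)
    hπW hΔW i

/-- **`C(W)` for every `W` dominated by a product of two varieties of dimension `≤ 2`** (points,
curves, surfaces; surjective `g : X ⊗ Y ⟶ W` of ANY relative dimension — e.g. every variety swept out
by a product of two curves or of a curve and a surface, every surface or threefold dominated by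
`S × S'`): `C` in dimension `≤ 2` (Voisin 2025 Cor. 3.9,
`kunnethComponent_diagonalClass_mem_algebraicClasses_of_le_two`), for products, and §2.
[cite: Kahn2020, §6.9 Lemma 6.30 (2)–(3) and Theorem 6.31 (1)–(2)] [cite: Voisin2025, §3.2.1 Cor. 3.9] -/
theorem kunnethComponents_algebraic_of_surjective_tensor_of_le_two (hX : IsSmoothProjective l X)
    (hY : IsSmoothProjective k Y) (hl : l ≤ 2) (hk : k ≤ 2) (hW : IsSmoothProjective m W)
    (g : X ⊗ Y ⟶ W) [Surjective g.left]
    {πW : Fin (2 * m + 1) → complexBetti (W ⊗ W) (2 * m)}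
    (hπW : ∀ i : Fin (2 * m + 1), πW i ∈ kunnethPiece W W (show (2 * m - (i : ℕ)) + i = 2 * m by omega))
    (hΔW : ∑ i, πW i = diagonalClass hW) (i : Fin (2 * m + 1)) :
    πW i ∈ algebraicClasses (W ⊗ W) m :=
  kunnethComponents_algebraic_of_surjective_tensor hX hY hW g
    (fun _ hπX hΔX j ↦ kunnethComponent_diagonalClass_mem_algebraicClasses_of_le_two hX hl hπX hΔX j)
    (fun _ hπY hΔY j ↦ kunnethComponent_diagonalClass_mem_algebraicClasses_of_le_two hY hk hπY hΔY j)
    hπW hΔW i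

/-- **`C(W)` for every `W` dominated by `A ⊗ Y`, `A` a complex abelian variety and `C(Y)`** (any
relative dimension). [cite: Kahn2020, §6.9 Lemma 6.30 (2)–(3) and Theorem 6.31 (3)] -/
theorem kunnethComponents_algebraic_of_surjective_abelianVariety_tensor (A : Motives.AbelianVariety ℂ)
    (hY : IsSmoothProjective k Y)
    (hCY : ∀ (πY : Fin (2 * k + 1) → complexBetti (Y ⊗ Y) (2 * k)),
      (∀ j : Fin (2 * k + 1), πY j ∈ kunnethPiece Y Y (show (2 * k - (j : ℕ)) + j = 2 * k by omega)) →
      ∑ j, πY j = diagonalClass hY → ∀ j, πY j ∈ algebraicClasses (Y ⊗ Y) k)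
    (hW : IsSmoothProjective m W) (g : A.X ⊗ Y ⟶ W) [Surjective g.left]
    {πW : Fin (2 * m + 1) → complexBetti (W ⊗ W) (2 * m)}
    (hπW : ∀ i : Fin (2 * m + 1), πW i ∈ kunnethPiece W W (show (2 * m - (i : ℕ)) + i = 2 * m by omega))
    (hΔW : ∑ i, πW i = diagonalClass hW) (i : Fin (2 * m + 1)) :
    πW i ∈ algebraicClasses (W ⊗ W) m :=
  kunnethComponents_algebraic_of_surjective_tensor (Motives.AbelianVariety.isSmoothProjective_holds (A := A))
    hY hW g (fun _ hπA hΔA j ↦ A.kunnethComponent_diagonalClass_mem_algebraicClasses hπA hΔA j) hCY hπW hΔW i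

/-- **`C(W)` for every `W` dominated by `A ⊗ Y` with `A` a complex abelian variety and `dim Y ≤ 2`**
(e.g. `A × S ↠ W` for a surface `S`, any relative dimension).
[cite: Kahn2020, §6.9 Lemma 6.30 (2)–(3) and Theorem 6.31] [cite: Voisin2025, §3.2.1 Cor. 3.9] -/
theorem kunnethComponents_algebraic_of_surjective_abelianVariety_tensor_of_le_two
    (A : Motives.AbelianVariety ℂ) (hY : IsSmoothProjective k Y) (hk : k ≤ 2)
    (hW : IsSmoothProjective m W) (g : A.X ⊗ Y ⟶ W) [Surjective g.left]
    {πW : Fin (2 * m + 1) → complexBetti (W ⊗ W) (2 * m)}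
    (hπW : ∀ i : Fin (2 * m + 1), πW i ∈ kunnethPiece W W (show (2 * m - (i : ℕ)) + i = 2 * m by omega))
    (hΔW : ∑ i, πW i = diagonalClass hW) (i : Fin (2 * m + 1)) :
    πW i ∈ algebraicClasses (W ⊗ W) m :=
  kunnethComponents_algebraic_of_surjective_abelianVariety_tensor A hY
    (fun _ hπY hΔY j ↦ kunnethComponent_diagonalClass_mem_algebraicClasses_of_le_two hY hk hπY hΔY j)
    hW g hπW hΔW i

/-- **`C(W)` for every `W` dominated by a triple product `(X ⊗ Y) ⊗ Z` of varieties of dimension `≤ 2`**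
(e.g. every variety swept out by a product of three curves, `C₁ × C₂ × C₃ ↠ W`, or by `C × C' × S`; any
relative dimension): `C` in dimension `≤ 2`, twice for products, and §2.
[cite: Kahn2020, §6.9 Lemma 6.30 (2)–(3) and Theorem 6.31 (1)–(2)] [cite: Voisin2025, §3.2.1 Cor. 3.9] -/
theorem kunnethComponents_algebraic_of_surjective_tensor_tensor_of_le_two (hX : IsSmoothProjective l X)
    (hY : IsSmoothProjective k Y) (hZ : IsSmoothProjective d Z) (hl : l ≤ 2) (hk : k ≤ 2) (hd : d ≤ 2)
    (hW : IsSmoothProjective m W) (g : (X ⊗ Y) ⊗ Z ⟶ W) [Surjective g.left]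
    {πW : Fin (2 * m + 1) → complexBetti (W ⊗ W) (2 * m)}
    (hπW : ∀ i : Fin (2 * m + 1), πW i ∈ kunnethPiece W W (show (2 * m - (i : ℕ)) + i = 2 * m by omega))
    (hΔW : ∑ i, πW i = diagonalClass hW) (i : Fin (2 * m + 1)) :
    πW i ∈ algebraicClasses (W ⊗ W) m :=
  kunnethComponents_algebraic_of_surjective_tensor (Motives.IsSmoothProjective.tensor_holds hX hY) hZ hW g
    (fun _ hπ hΔ j ↦ kunnethComponent_diagonalClass_mem_algebraicClasses_tensor_of_le_two hX hY hl hk hπ hΔ j)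
    (fun _ hπZ hΔZ j ↦ kunnethComponent_diagonalClass_mem_algebraicClasses_of_le_two hZ hd hπZ hΔZ j)
    hπW hΔW i

end Literature.AlgebraicGeometry.HodgeTheory

end
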